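import Summits.AtomisticToContinuum.HydrodynamicLimit.Theorems.CollisionIsometryCLTCollisionalTransferLocalityGaussMarks
import HarnessLib

/-!
# Static law of large numbers for the free-streaming observable at equilibrium

Helper file (`--supports stmt-AtomisticToContinuum-9518`, line `hemisphere-affine-slaving`, skeleton
v10.1) for the crux `CollisionalTransferLocality`: the registered stub `stream_lln_const` of the
equilibrium rung.

In the crux's residual the free-streaming term of the balance law is the one-time empirical average
`B(z) = (N+1)⁻¹ Σᵢ [Σ_{ab} Gm(xᵢ)_{ab} v_{i,a} v_{i,b} + (Σ_a gv(xᵢ)_a v_{i,a}) |vᵢ|²/2]`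
(`deriv_Obs_freeFlight_eq`, with `Gm = ∇ψ_s`, `gv = ∇χ_s`). Under the homogeneous local Gibbs law
`G_N = localGibbsLaw σ 1 0 θ N (Φ N)` (activity `1`, velocity `0`, temperature `θ`) the velocities
are, conditionally on the positions, i.i.d. centred Maxwellians `gaussMeasure 0 θ`, whose second
moments are `θ δ_{ab}` and whose third moments vanish
(`integral_coord_mul_coord_gaussMeasure_zero`, `integral_coord_mul_norm_sq_gaussMeasure_zero`).
Hence `B` splits into

* nine velocity fluctuations `(N+1)⁻¹ Σᵢ Gm(xᵢ)_{ab} (v_{i,a} v_{i,b} - θ δ_{ab})`,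
* three velocity fluctuations `(N+1)⁻¹ Σᵢ (gv(xᵢ)_a / 2) (v_{i,a} |vᵢ|²)`,
* the density field `(N+1)⁻¹ Σᵢ θ Σ_a Gm(xᵢ)_{aa}`,

(`stream_split`); each fluctuation is `O((N+1)^{-1/2})` in probability by the conditional
Bienaymé–Chebyshev inequality of the tree (`localGibbsMeasure_velFluct_le`, here in the `Tendsto`
form `tendsto_localGibbsMeasure_const_velFluct`, the mass-one hypothesis replacing the smallness
of `σ`), and the density field converges to `θ ∫ Σ_a Gm_{aa}` by the density law of large numbers taken
as a hypothesis (the conclusion of the landed `localGibbsLaw_const_densityLLN`). The deviation events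
are recombined by the union bound (`tendsto_measure_lt_abs_add_of_forall`,
`tendsto_measure_lt_abs_finset_sum`). Everything here is folklore bookkeeping around Spohn's static
law of large numbers for local equilibrium states (H. Spohn, *Large Scale Dynamics of Interacting
Particles* (1991), Part I §2.3); nothing is cited and no dynamics enters.
-/

namespace Summit.AtomisticToContinuum.HydrodynamicLimit.Theorems.HemisphereAffineSlaving

open scoped BigOperators Topology Classical ENNReal InnerProductSpace
open Filter Set Function MeasureTheory

noncomputable section

open Literature.MathematicalPhysics.KineticTheory (T3 V3)
open ProbabilityTheory
open Literature.MathematicalPhysics.KineticTheory (gaussMeasure localGibbsMeasure localGibbsLaw_eq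
  localGibbsMeasure_velFluct_le empiricalDensityField empiricalDensityField_eq_sum
  exists_forall_abs_le_of_continuous tendsto_measure_lt_abs_add tendsto_ofReal_div_succ_mul)

/-! ### Deviation events of sums -/

/-- **Splitting of deviation events**, symmetric form quantified over all levels: if
`P_N(η < |A_N|) → 0` and `P_N(η < |B_N|) → 0` for every `η > 0`, then `P_N(η < |A_N + B_N|) → 0`
for every `η > 0`. [folklore] -/
theorem tendsto_measure_lt_abs_add_of_forall {Ω : ℕ → Type*} [∀ N, MeasurableSpace (Ω N)]
    {P : (N : ℕ) → Measure (Ω N)} {A B : (N : ℕ) → Ω N → ℝ}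
    (hA : ∀ η : ℝ, 0 < η → Tendsto (fun N => P N {z | η < |A N z|}) atTop (𝓝 0))
    (hB : ∀ η : ℝ, 0 < η → Tendsto (fun N => P N {z | η < |B N z|}) atTop (𝓝 0)) :
    ∀ η : ℝ, 0 < η → Tendsto (fun N => P N {z | η < |A N z + B N z|}) atTop (𝓝 0) := by
  intro η hη
  have hA' : Tendsto (fun N => P N {z | η / 2 ≤ |A N z|}) atTop (𝓝 0) :=
    tendsto_of_tendsto_of_tendsto_of_le_of_le tendsto_const_nhds (hA (η / 4) (by positivity))
      (fun N => zero_le) fun N => measure_mono fun z (hz : η / 2 ≤ |A N z|) =>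
        show η / 4 < |A N z| by linarith
  have h := tendsto_measure_lt_abs_add hA' (hB (η / 2) (by positivity))
  rwa [show (2 : ℝ) * (η / 2) = η by ring] at h

/-- **Union bound for finite sums of small terms**: if `P_N(η < |A_{k,N}|) → 0` for every `k ∈ s`
and every `η > 0`, then `P_N(η < |Σ_{k ∈ s} A_{k,N}|) → 0` for every `η > 0`. [folklore] -/
theorem tendsto_measure_lt_abs_finset_sum {Ω : ℕ → Type*} [∀ N, MeasurableSpace (Ω N)]
    {P : (N : ℕ) → Measure (Ω N)} {ι : Type*} (s : Finset ι) {A : ι → (N : ℕ) → Ω N → ℝ}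
    (hA : ∀ k ∈ s, ∀ η : ℝ, 0 < η → Tendsto (fun N => P N {z | η < |A k N z|}) atTop (𝓝 0)) :
    ∀ η : ℝ, 0 < η → Tendsto (fun N => P N {z | η < |∑ k ∈ s, A k N z|}) atTop (𝓝 0) := by
  induction s using Finset.induction_on with
  | empty =>
    intro η hη
    have h0 : (fun N => P N {z | η < |∑ k ∈ (∅ : Finset ι), A k N z|}) = fun _ => 0 := by
      funext N
      simp [not_lt.2 hη.le]
    rw [h0]
    exact tendsto_const_nhds
  | @insert k s hk ih =>
    intro η hη
    have h := tendsto_measure_lt_abs_add_of_forall (hA k (Finset.mem_insert_self k s))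
      (ih fun j hj => hA j (Finset.mem_insert_of_mem hj)) η hη
    simpa only [Finset.sum_insert hk] using h

/-! ### Velocity fluctuations under the homogeneous local Gibbs measure -/

/-- **Velocity fluctuations tend to zero under the homogeneous local Gibbs measure.** For a
measurable mark `Y : ℝ³ → ℝ` which is centred and square integrable under the centred Maxwellian
`gaussMeasure 0 θ` (`θ > 0`) and a continuous test function `χ` on `𝕋³`: if the measures
`localGibbsMeasure σ 1 0 θ N` have mass one, then for every `η > 0` the probability that
`|(N+1)⁻¹ Σᵢ χ(xᵢ) Y(vᵢ)| > η` tends to `0` (rate `(N+1)⁻¹`, conditional Bienaymé–Chebyshev: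
`localGibbsMeasure_velFluct_le` with the variance of `Y` itself as the variance bound).
[folklore] -/
theorem tendsto_localGibbsMeasure_const_velFluct {σ θ : ℝ} (hθ : 0 < θ)
    (hP : ∀ N, IsProbabilityMeasure
      (localGibbsMeasure σ (fun _ => 1) (fun _ => 0) (fun _ => θ) N))
    {Y : V3 → ℝ} (hYm : Measurable Y) (hY2 : MemLp Y 2 (gaussMeasure (0 : V3) θ))
    (hY0 : ∫ v, Y v ∂gaussMeasure (0 : V3) θ = 0) {χ : T3 → ℝ} (hχ : Continuous χ) :
    ∀ η : ℝ, 0 < η → Tendsto (fun N =>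
      localGibbsMeasure σ (fun _ => 1) (fun _ => 0) (fun _ => θ) N
        {z | η < |((N + 1 : ℕ) : ℝ)⁻¹ * ∑ i, χ (z i).1 * Y (z i).2|}) atTop (𝓝 0) := by
  intro η hη
  obtain ⟨C, -, hC⟩ := exists_forall_abs_le_of_continuous hχ
  refine tendsto_of_tendsto_of_tendsto_of_le_of_le tendsto_const_nhds
    (tendsto_ofReal_div_succ_mul (C ^ 2 * Var[Y; gaussMeasure (0 : V3) θ]) (η ^ 2))
    (fun N => zero_le) (fun N => ?_)
  haveI := hP N
  exact (measure_mono fun z (hz : η < _) => show η ≤ _ from hz.le).trans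
    (localGibbsMeasure_velFluct_le (a₀ := fun _ => 1) (u₀ := fun _ => 0) (θ₀ := fun _ => θ)
      continuous_const continuous_const continuous_const (fun _ => zero_le_one) (fun _ => hθ) σ N
      (Y := fun _ v => Y v) (hYm.comp measurable_snd) (fun _ => hY2) (fun _ => hY0)
      (fun _ => le_rfl) hχ hC hη)

/-! ### The algebraic splitting of the free-streaming integrand -/

/-- Contraction of the Kronecker delta:
`Σ_{ab} G_{ab} (v_a v_b - θ δ_{ab}) = Σ_{ab} G_{ab} v_a v_b - θ Σ_a G_{aa}`. [folklore] -/
theorem sum_sum_mul_sub_ite (θ : ℝ) (G : Fin 3 → Fin 3 → ℝ) (v : V3) :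
    (∑ a, ∑ b, G a b * (v a * v b - if a = b then θ else 0)) =
      (∑ a, ∑ b, G a b * v a * v b) - θ * ∑ a, G a a := by
  simp only [mul_sub, Finset.sum_sub_distrib, mul_ite, mul_zero, Finset.sum_ite_eq,
    Finset.mem_univ, if_true, Finset.mul_sum, mul_assoc]
  congr 1
  exact Finset.sum_congr rfl fun a _ => mul_comm _ _

/-- **Per-particle splitting of the free-streaming integrand** into the centred second-moment marks,
the third-moment marks and the trace term:
`Σ_{ab} G_{ab} v_a v_b + (Σ_a g_a v_a) |v|²/2
  = Σ_{ab} G_{ab} (v_a v_b - θ δ_{ab}) + Σ_a (g_a/2) (v_a |v|²) + θ Σ_a G_{aa}`. [folklore] -/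
theorem stream_integrand_split (θ : ℝ) (G : Fin 3 → Fin 3 → ℝ) (g v : V3) :
    (∑ a, ∑ b, G a b * v a * v b) + (∑ a, g a * v a) * (‖v‖ ^ 2 / 2) =
      (∑ a, ∑ b, G a b * (v a * v b - if a = b then θ else 0)) +
        (∑ a, g a / 2 * (v a * ‖v‖ ^ 2)) + θ * ∑ a, G a a := by
  rw [sum_sum_mul_sub_ite, Finset.sum_mul]
  have h : ∑ a, g a * v a * (‖v‖ ^ 2 / 2) = ∑ a, g a / 2 * (v a * ‖v‖ ^ 2) :=
    Finset.sum_congr rfl fun a _ => by ring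
  rw [h]
  ring

/-- **Splitting of the centred free-streaming observable** of a configuration `z` of `N + 1`
spheres into the nine second-moment fluctuation averages, the three third-moment fluctuation
averages, and the density field of `θ Σ_a Gm_{aa}` centred at its mean. [folklore] -/
theorem stream_split {N : ℕ} (θ : ℝ) (Gm : T3 → Fin 3 → Fin 3 → ℝ) (gv : T3 → V3) (z : Cfg N) :
    ((N : ℝ) + 1)⁻¹ * (∑ i : Fin (N + 1), ((∑ a, ∑ b, Gm (z i).1 a b * (z i).2 a * (z i).2 b) +
        (∑ a, gv (z i).1 a * (z i).2 a) * (‖(z i).2‖ ^ 2 / 2))) - θ * ∫ x, (∑ a, Gm x a a) =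
      (∑ a, ∑ b, ((N + 1 : ℕ) : ℝ)⁻¹ *
          ∑ i, Gm (z i).1 a b * ((z i).2 a * (z i).2 b - if a = b then θ else 0)) +
        (∑ a, ((N + 1 : ℕ) : ℝ)⁻¹ * ∑ i, gv (z i).1 a / 2 * ((z i).2 a * ‖(z i).2‖ ^ 2)) +
        (empiricalDensityField z (fun x => θ * ∑ a, Gm x a a) - ∫ x, θ * ∑ a, Gm x a a) := by
  rw [empiricalDensityField_eq_sum, integral_const_mul, Nat.cast_succ]
  have h1 : (∑ a, ∑ b, ((N : ℝ) + 1)⁻¹ *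
        ∑ i, Gm (z i).1 a b * ((z i).2 a * (z i).2 b - if a = b then θ else 0)) =
      ((N : ℝ) + 1)⁻¹ *
        ∑ i, ∑ a, ∑ b, Gm (z i).1 a b * ((z i).2 a * (z i).2 b - if a = b then θ else 0) := by
    simp only [Finset.mul_sum]
    exact Finset.sum_comm_cycle
  have h2 : (∑ a, ((N : ℝ) + 1)⁻¹ * ∑ i, gv (z i).1 a / 2 * ((z i).2 a * ‖(z i).2‖ ^ 2)) =
      ((N : ℝ) + 1)⁻¹ * ∑ i, ∑ a, gv (z i).1 a / 2 * ((z i).2 a * ‖(z i).2‖ ^ 2) := by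
    simp only [Finset.mul_sum]
    exact Finset.sum_comm
  rw [h1, h2]
  simp only [stream_integrand_split θ, Finset.sum_add_distrib]
  ring

/-! ### The registered stub -/

/-- **Registered stub `stream_lln_const`** (equilibrium-rung infrastructure of the line
`hemisphere-affine-slaving`, crux stmt-AtomisticToContinuum-9518): the STATIC LAW OF LARGE NUMBERS
for the free-streaming observable under the homogeneous local Gibbs law. Let `θ > 0`, let `Φ` be a
flow family, and assume that the laws `G_N = localGibbsLaw σ 1 0 θ N (Φ N)` have mass one and
satisfy the density law of large numbers with limit `∫ f` (the two conclusions of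
`localGibbsLaw_const_densityLLN`). Then for continuous coefficients `Gm : 𝕋³ → ℝ^{3×3}`,
`gv : 𝕋³ → ℝ³` and every `δ > 0`,
`G_N {δ < |(N+1)⁻¹ Σᵢ [Σ_{ab} Gm(xᵢ)_{ab} v_{i,a} v_{i,b} + (Σ_a gv(xᵢ)_a v_{i,a}) |vᵢ|²/2]
  - θ ∫ Σ_a Gm_{aa}|} → 0`:
the second velocity moments average to `θ δ_{ab}`, the third to `0`. Proof: `stream_split`, the
conditional Chebyshev bound for the twelve fluctuation averages
(`tendsto_localGibbsMeasure_const_velFluct` with the Gaussian marks of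
`CollisionIsometryCLTCollisionalTransferLocalityGaussMarks`), the density hypothesis for
`f = θ Σ_a Gm_{aa}`, and the union bound. [folklore] -/
theorem stream_lln_const : ∀ {σ θ : ℝ}, 0 < θ → ∀ (Φ : Flows σ), (∀ N, IsProbabilityMeasure (Literature.MathematicalPhysics.KineticTheory.localGibbsLaw σ (fun _ => 1) (fun _ => 0) (fun _ => θ) N (Φ N))) → (∀ f : T3 → ℝ, Continuous f → ∀ δ : ℝ, 0 < δ → Tendsto (fun N : ℕ => Literature.MathematicalPhysics.KineticTheory.localGibbsLaw σ (fun _ => 1) (fun _ => 0) (fun _ => θ) N (Φ N) {z | δ < |Literature.MathematicalPhysics.KineticTheory.empiricalDensityField z f - ∫ x, f x|}) atTop (𝓝 0)) → ∀ (Gm : T3 → Fin 3 → Fin 3 → ℝ) (gv : T3 → V3), (∀ a b, Continuous fun x => Gm x a b) → Continuous gv → ∀ δ : ℝ, 0 < δ → Tendsto (fun N : ℕ => Literature.MathematicalPhysics.KineticTheory.localGibbsLaw σ (fun _ => 1) (fun _ => 0) (fun _ => θ) N (Φ N) {z | δ < |((N : ℝ) + 1)⁻¹ * (∑ i : Fin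 (N + 1), ((∑ a, ∑ b, Gm (z i).1 a b * (z i).2 a * (z i).2 b) + (∑ a, gv (z i).1 a * (z i).2 a) * (‖(z i).2‖ ^ 2 / 2))) - θ * ∫ x, (∑ a, Gm x a a)|}) atTop (𝓝 0) := by
  intro σ θ hθ Φ hP hdens Gm gv hGm hgv δ hδ
  -- mass one of the flow-free law
  have hP' : ∀ N, IsProbabilityMeasure
      (localGibbsMeasure σ (fun _ => 1) (fun _ => 0) (fun _ => θ) N) :=
    fun N => localGibbsLaw_eq σ _ _ _ N (Φ N) ▸ hP N
  -- (i) the nine second-moment fluctuation averages (the statements are assembled by `have`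
  -- first: unifying against the expected type before `χ`, `Y` are known unfolds real arithmetic)
  have hA : ∀ a b : Fin 3, ∀ η : ℝ, 0 < η → Tendsto (fun N =>
      localGibbsMeasure σ (fun _ => 1) (fun _ => 0) (fun _ => θ) N
        {z | η < |((N + 1 : ℕ) : ℝ)⁻¹ *
          ∑ i, Gm (z i).1 a b * ((z i).2 a * (z i).2 b - if a = b then θ else 0)|})
      atTop (𝓝 0) := by
    intro a b
    have hY2 : MemLp (fun v : V3 => v a * v b - if a = b then θ else 0) 2
        (gaussMeasure (0 : V3) θ) :=
      (memLp_two_coord_mul_coord_gaussMeasure θ a b).sub (memLp_const _)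
    have hY0 : ∫ v, (v a * v b - if a = b then θ else 0) ∂gaussMeasure (0 : V3) θ = 0 := by
      rw [integral_sub ((memLp_two_coord_mul_coord_gaussMeasure θ a b).integrable one_le_two)
        (integrable_const _), integral_coord_mul_coord_gaussMeasure_zero hθ a b, integral_const]
      simp
    have h := tendsto_localGibbsMeasure_const_velFluct (χ := fun x => Gm x a b)
      (Y := fun v : V3 => v a * v b - if a = b then θ else 0) hθ hP' (by fun_prop) hY2 hY0
      (hGm a b)
    exact h
  -- (ii) the three third-moment fluctuation averages
  have hB : ∀ a : Fin 3, ∀ η : ℝ, 0 < η → Tendsto (fun N =>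
      localGibbsMeasure σ (fun _ => 1) (fun _ => 0) (fun _ => θ) N
        {z | η < |((N + 1 : ℕ) : ℝ)⁻¹ *
          ∑ i, gv (z i).1 a / 2 * ((z i).2 a * ‖(z i).2‖ ^ 2)|}) atTop (𝓝 0) := by
    intro a
    have h := tendsto_localGibbsMeasure_const_velFluct (χ := fun x => gv x a / 2)
      (Y := fun v : V3 => v a * ‖v‖ ^ 2) hθ hP' (by fun_prop)
      (memLp_two_coord_mul_norm_sq_gaussMeasure θ a)
      (integral_coord_mul_norm_sq_gaussMeasure_zero hθ a)
      (by fun_prop)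
    exact h
  -- (iii) the trace term: the density law of large numbers for `f = θ Σ_a Gm_{aa}`
  have hD : ∀ η : ℝ, 0 < η → Tendsto (fun N =>
      localGibbsMeasure σ (fun _ => 1) (fun _ => 0) (fun _ => θ) N
        {z | η < |empiricalDensityField z (fun x => θ * ∑ a, Gm x a a) -
          ∫ x, θ * ∑ a, Gm x a a|}) atTop (𝓝 0) := by
    intro η hη
    have h := hdens (fun x => θ * ∑ a, Gm x a a)
      (continuous_const.mul (continuous_finsetSum _ fun a _ => hGm a a)) η hη
    simpa only [localGibbsLaw_eq] using h
  -- union bound over the 9 + 3 + 1 pieces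
  have hS1 : ∀ η : ℝ, 0 < η → Tendsto (fun N =>
      localGibbsMeasure σ (fun _ => 1) (fun _ => 0) (fun _ => θ) N
        {z | η < |∑ a, ∑ b, ((N + 1 : ℕ) : ℝ)⁻¹ *
          ∑ i, Gm (z i).1 a b * ((z i).2 a * (z i).2 b - if a = b then θ else 0)|})
      atTop (𝓝 0) :=
    tendsto_measure_lt_abs_finset_sum Finset.univ fun a _ =>
      tendsto_measure_lt_abs_finset_sum Finset.univ fun b _ => hA a b
  have hS2 : ∀ η : ℝ, 0 < η → Tendsto (fun N =>
      localGibbsMeasure σ (fun _ => 1) (fun _ => 0) (fun _ => θ) N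
        {z | η < |∑ a, ((N + 1 : ℕ) : ℝ)⁻¹ *
          ∑ i, gv (z i).1 a / 2 * ((z i).2 a * ‖(z i).2‖ ^ 2)|}) atTop (𝓝 0) :=
    tendsto_measure_lt_abs_finset_sum Finset.univ fun a _ => hB a
  have hsum := tendsto_measure_lt_abs_add_of_forall (tendsto_measure_lt_abs_add_of_forall hS1 hS2)
    hD δ hδ
  refine hsum.congr fun N => ?_
  rw [localGibbsLaw_eq]
  congr 1
  ext z
  simp only [Set.mem_setOf_eq]
  rw [stream_split θ Gm gv z]

end

end Summit.AtomisticToContinuum.HydrodynamicLimit.Theorems.HemisphereAffineSlaving
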